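import Literature.Algebra.Lie.ChevalleyEilenbergFunctoriality
import HarnessLib

/-!
# Extra scalars on Chevalley–Eilenberg cohomology

Topic `Algebra/Lie`; namespace `Literature.Algebra.Lie.ChevalleyEilenberg`.  Definitions with
bodies and theorems only (no named fact, no `sorry`).

When a commutative ring `A` acts on the `L`-module `M` (over `R`) by `L`-module endomorphisms
commuting with the `R`-scalars — the situation of a COMPLEX representation `V` of a REAL Lie
algebra `𝔤` (`R = ℝ`, `A = ℂ`), as for the `(𝔤, K)`-modules of `GKModules` — the cochains
`C^q(L; M) = Hom_R(Λ^q L, M)` are `A`-modules (Mathlib), `d`, `i_x`, `θ_x` are `A`-linear, and the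
cohomology of every `A`-stable subcomplex is an `A`-module.  This is how
`H^q(𝔤, K; V) = H(Hom_K(Λ^q(𝔤/𝔨), V))` [cite: BorelWallach2000, I §5.1 (1)] (`F = ℝ` there)
acquires its complex structure from `V`.

* `LieSMulComm A L M` (class) — `⁅x, a • m⁆ = a • ⁅x, m⁆`; `smulHom R L a : M →ₗ⁅R,L⁆ M`;
  `map_smulHom` (`(a •)_* f = a • f`), `d_smul`, `ins_smul'`, `lieDer_smul`;
  `Cochain.instIsScalarTower`;
* `Subcomplex.SMulStable S A` (class) with instances `top`, `rel K`, `inf`,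
  `PairAction.fixedSubcomplex` (for pair actions with `PairAction.SMulComm`: `τ_g` `A`-linear),
  hence `Subcomplex.gK`;
* `Subcomplex.cohomologySMul`, `Subcomplex.cohomologyModule` — **`H^q(S)` is an `A`-module**
  (`a • [z] = [a • z]`, `smul_toCohomology`), `Subcomplex.cohomology_isScalarTower`
  (`IsScalarTower R A`), `IsCochainMapTo.cohomologyMap_smul` (induced maps are `A`-linear).

## References

* A. Borel, N. Wallach (2000), I §5.1 (held) [BorelWallach2000].
-/

open Fin Function

namespace Literature.Algebra.Lie

namespace ChevalleyEilenberg

variable {R : Type*} [CommRing R] {L : Type*} [LieRing L] [LieAlgebra R L]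
  {M : Type*} [AddCommGroup M] [Module R M]

section Scalars

variable (A : Type*) [CommRing A] [Module A M] [SMulCommClass R A M] [LieRingModule L M]

/-- The scalars `A` act on the `L`-module `M` by `L`-module endomorphisms:
`⁅x, a • m⁆ = a • ⁅x, m⁆` (e.g. `A = ℂ` on a complex representation of a real Lie algebra).
[folklore] -/
class LieSMulComm (A L M : Type*) [SMul A M] [Bracket L M] : Prop where
  /-- the bracket commutes with the `A`-scalars -/
  lie_smul_comm : ∀ (a : A) (x : L) (m : M), ⁅x, a • m⁆ = a • ⁅x, m⁆

variable {A} [LieSMulComm A L M]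

variable (R L) in
/-- Multiplication by `a ∈ A` as an endomorphism of the `L`-module `M` (over `R`). [folklore] -/
def smulHom (a : A) : M →ₗ⁅R,L⁆ M where
  toFun m := a • m
  map_add' := smul_add a
  map_smul' r m := (smul_comm r a m).symm
  map_lie' {x m} := (LieSMulComm.lie_smul_comm a x m).symm

omit [LieAlgebra R L] in
/-- `smulHom a m = a • m`. [folklore] -/
@[simp] theorem smulHom_apply (a : A) (m : M) : smulHom R L a m = a • m := rfl

/-- Postcomposition with `a •` is the `A`-scalar multiplication of cochains. [folklore] -/
theorem map_smulHom (a : A) (q : ℕ) (f : Cochain R L M q) :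
    map L (smulHom R L a) q f = a • f := by
  ext v
  rfl

/-- `i_x` is `A`-linear. [folklore] -/
theorem ins_smul' (a : A) (q : ℕ) (x : L) (f : Cochain R L M (q + 1)) :
    ins q x (a • f) = a • ins q x f := by
  rw [← map_smulHom (R := R) (L := L) a (q + 1) f, ins_map, map_smulHom]

/-- Scalar towers pass to cochains (Mathlib records only `SMulCommClass` for alternating maps).
[folklore] -/
instance Cochain.instIsScalarTower {S T : Type*} [Monoid S] [Monoid T] [DistribMulAction S M]
    [DistribMulAction T M] [SMulCommClass R S M] [SMulCommClass R T M] [SMul S T]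
    [IsScalarTower S T M] (q : ℕ) : IsScalarTower S T (Cochain R L M q) :=
  ⟨fun _ _ _ => AlternatingMap.ext fun _ => smul_assoc _ _ _⟩

variable [LieModule R L M]

/-- `d` is `A`-linear. [folklore] -/
theorem d_smul (a : A) (q : ℕ) (f : Cochain R L M q) :
    d R L M q (a • f) = a • d R L M q f := by
  rw [← map_smulHom (R := R) (L := L), d_map, map_smulHom]

/-- `θ_x` is `A`-linear. [folklore] -/
theorem lieDer_smul (a : A) (q : ℕ) (x : L) (f : Cochain R L M q) :
    lieDer R L M q x (a • f) = a • lieDer R L M q x f := by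
  rw [← map_smulHom (R := R) (L := L) a q f, lieDer_map, map_smulHom]

/-- A subcomplex is `A`-stable if each `S_q` is closed under the `A`-scalars. [folklore] -/
class Subcomplex.SMulStable (S : Subcomplex R L M) (A : Type*) [CommRing A] [Module A M]
    [SMulCommClass R A M] : Prop where
  /-- `a • S_q ⊆ S_q` -/
  smul_mem : ∀ (q : ℕ) (a : A) (f : Cochain R L M q), f ∈ S.carrier q → a • f ∈ S.carrier q

/-- All cochains: `A`-stable. [folklore] -/
instance Subcomplex.top_smulStable : (Subcomplex.top R L M).SMulStable A := ⟨fun _ _ _ _ => trivial⟩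

/-- Relative cochains: `A`-stable. [cite: BorelWallach2000, I §1.2] -/
instance Subcomplex.rel_smulStable (K : LieSubalgebra R L) :
    (Subcomplex.rel R L M K).SMulStable A where
  smul_mem q a f hf := by
    rw [← map_smulHom (R := R) (L := L)]
    exact map_mem_rel K (smulHom R L a) q f hf

/-- Intersections of `A`-stable subcomplexes are `A`-stable. [folklore] -/
instance Subcomplex.inf_smulStable (S T : Subcomplex R L M) [S.SMulStable A] [T.SMulStable A] :
    (S.inf T).SMulStable A where
  smul_mem q a f hf := Submodule.mem_inf.2
    ⟨Subcomplex.SMulStable.smul_mem q a f (Submodule.mem_inf.1 hf).1,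
      Subcomplex.SMulStable.smul_mem q a f (Submodule.mem_inf.1 hf).2⟩

variable {Γ : Type*} [Group Γ]

/-- A pair action whose module part commutes with the `A`-scalars. [folklore] -/
class PairAction.SMulComm (P : PairAction R L M Γ) (A : Type*) [SMul A M] : Prop where
  /-- `τ_g (a • m) = a • τ_g m` -/
  τ_smul : ∀ (g : Γ) (a : A) (m : M), P.τ g (a • m) = a • P.τ g m

/-- Fixed cochains of an `A`-compatible pair action: `A`-stable. [folklore] -/
instance PairAction.fixedSubcomplex_smulStable (P : PairAction R L M Γ) [P.SMulComm A] :
    P.fixedSubcomplex.SMulStable A where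
  smul_mem q a f hf := by
    change f ∈ P.fixed q at hf
    change a • f ∈ P.fixed q
    rw [PairAction.mem_fixed_iff] at hf ⊢
    intro g
    rw [← map_smulHom (R := R) (L := L), PairAction.act_map P (smulHom R L a) (fun g => ?_), hf g]
    ext m
    exact PairAction.SMulComm.τ_smul g a m

/-- The `(𝔤, K)`-complex of an `A`-compatible pair action: `A`-stable.
[cite: BorelWallach2000, I §5.1 (1)] -/
instance Subcomplex.gK_smulStable (K : LieSubalgebra R L) (P : PairAction R L M Γ) [P.SMulComm A] :
    (Subcomplex.gK R L M K P).SMulStable A :=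
  Subcomplex.inf_smulStable (A := A) _ _

/-! #### The `A`-module structure on the cohomology of an `A`-stable subcomplex -/

variable (S : Subcomplex R L M) [S.SMulStable A]

/-- Multiplication by `a` is a cochain map of an `A`-stable subcomplex to itself. [folklore] -/
theorem Subcomplex.isCochainMapTo_smul (a : A) :
    S.IsCochainMapTo S (map L (smulHom R L a)) :=
  ⟨fun q f => d_map _ q f, fun q f hf => by
    rw [map_smulHom]; exact Subcomplex.SMulStable.smul_mem q a f hf⟩

/-- The `A`-scalar multiplication on `H^q(S)`: the map induced by the cochain map `a •`.
[folklore] -/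
instance Subcomplex.cohomologySMul (q : ℕ) : SMul A (S.Cohomology q) :=
  ⟨fun a x => (S.isCochainMapTo_smul (A := A) a).cohomologyMap q x⟩

/-- Unfolding of the scalar multiplication on `H^q(S)`. [folklore] -/
theorem Subcomplex.smul_def (q : ℕ) (a : A) (x : S.Cohomology q) :
    a • x = (S.isCochainMapTo_smul (A := A) a).cohomologyMap q x := rfl

/-- `a • [z] = [a • z]`. [folklore] -/
theorem Subcomplex.smul_toCohomology (q : ℕ) (a : A) (z : S.cocycles q) :
    a • S.toCohomology q z =
      S.toCohomology q ⟨a • (z : Cochain R L M q),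
        by simpa only [map_smulHom] using
          (S.isCochainMapTo_smul (A := A) a).mapsTo_cocycles q _ z.2⟩ := by
  rw [Subcomplex.smul_def, Subcomplex.IsCochainMapTo.cohomologyMap_toCohomology]
  congr 1

/-- **`H^q(S)` is an `A`-module** for an `A`-stable subcomplex `S` (e.g. the complex
`(𝔤, K)`-cohomology of a complex `(𝔤, K)`-module of a real Lie algebra is a complex vector
space). [cite: BorelWallach2000, I §5.1 (1)] -/
instance Subcomplex.cohomologyModule (q : ℕ) : Module A (S.Cohomology q) where
  one_smul x := by
    obtain ⟨z, rfl⟩ := S.toCohomology_surjective q x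
    rw [Subcomplex.smul_toCohomology]
    congr 1; ext1; exact one_smul A _
  mul_smul a b x := by
    obtain ⟨z, rfl⟩ := S.toCohomology_surjective q x
    simp only [Subcomplex.smul_toCohomology]
    congr 1; ext1; exact mul_smul a b _
  smul_zero a := by
    rw [Subcomplex.smul_def, map_zero]
  smul_add a x y := by
    rw [Subcomplex.smul_def, map_add]; rfl
  add_smul a b x := by
    obtain ⟨z, rfl⟩ := S.toCohomology_surjective q x
    simp only [Subcomplex.smul_toCohomology, ← map_add]
    congr 1; ext1; exact add_smul a b _
  zero_smul x := by
    obtain ⟨z, rfl⟩ := S.toCohomology_surjective q x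
    rw [Subcomplex.smul_toCohomology, ← (S.toCohomology q).map_zero]
    congr 1; ext1; exact zero_smul A _

/-- The `R`- and `A`-module structures on `H^q(S)` are compatible. [folklore] -/
instance Subcomplex.cohomology_isScalarTower (q : ℕ) [Algebra R A] [IsScalarTower R A M] :
    IsScalarTower R A (S.Cohomology q) where
  smul_assoc r a x := by
    obtain ⟨z, rfl⟩ := S.toCohomology_surjective q x
    rw [Subcomplex.smul_toCohomology, Subcomplex.smul_toCohomology, ← map_smul]
    congr 1; ext1
    change (r • a) • (z : Cochain R L M q) = r • a • (z : Cochain R L M q)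
    exact smul_assoc r a _

/-- `toCohomology` is `A`-linear. [folklore] -/
theorem Subcomplex.toCohomology_smul (q : ℕ) (a : A) (z : S.cocycles q)
    (haz : a • (z : Cochain R L M q) ∈ S.cocycles q) :
    S.toCohomology q ⟨a • (z : Cochain R L M q), haz⟩ = a • S.toCohomology q z := by
  rw [Subcomplex.smul_toCohomology]

/-- Induced maps on cohomology are `A`-linear when the cochain map commutes with the scalars.
[folklore] -/
theorem Subcomplex.IsCochainMapTo.cohomologyMap_smul {L' : Type*} [LieRing L'] [LieAlgebra R L']
    {M' : Type*} [AddCommGroup M'] [Module R M'] [LieRingModule L' M'] [LieModule R L' M']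
    [Module A M'] [SMulCommClass R A M'] [LieSMulComm A L' M']
    {T : Subcomplex R L' M'} [T.SMulStable A]
    {F : (q : ℕ) → Cochain R L M q →ₗ[R] Cochain R L' M' q}
    (h : S.IsCochainMapTo T F) (hF : ∀ q (a : A) f, F q (a • f) = a • F q f) (q : ℕ) (a : A)
    (x : S.Cohomology q) : h.cohomologyMap q (a • x) = a • h.cohomologyMap q x := by
  obtain ⟨z, rfl⟩ := S.toCohomology_surjective q x
  rw [Subcomplex.smul_toCohomology, h.cohomologyMap_toCohomology, h.cohomologyMap_toCohomology,
    Subcomplex.smul_toCohomology]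
  congr 1; ext1
  simp only [Subcomplex.IsCochainMapTo.coe_cocyclesMap]
  exact hF q a z

end Scalars

end ChevalleyEilenberg

end Literature.Algebra.Lie
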